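import Summits.ResolutionOfSingularities.ResolutionOfSingularities.Theorems.PurelyInseparableDim4JointForestRootWaiting
import Summits.ResolutionOfSingularities.ResolutionOfSingularities.Theorems.PurelyInseparableDim4JointWaitingToyComputations
import HarnessLib

/-!
# Purely inseparable four-folds: the v3-lite TOY CERTIFIED — two INTERSECTING root surfaces, one blown up, the other
# WAITING, then its strict transform blown up (brick S3 (c) «joint point∘coordinate chains», part 39 = instance inst₁₁;
# cell `res-dim4-pi`)

[OURS · counted 0] (D-0157 DOOR 2; desk WORD #66 (4)(c), #74 (g), #99 (d); frame `PIDim4.TerminationImpliesOrderReduction`,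
S3 (c) v3-lite, memo `S3c-V3-DESIGN.md` Addendum 2; host item stmt-ResolutionOfSingularities-16155, helper). Nothing here
proves resolution of singularities in dimension ≥ 4 / characteristic `p` — NOT here, not anywhere in this programme.

`F = x₁^p x₄ + x₁x₂^{p−1}(x₃^p − 1)` over `K = K̄` of characteristic `p ≥ 3` (variables `x₁…x₄` = `X 0…X 3`). Its order-`p`
locus is the union of the two surfaces `V(z, x₁, x₂)` and `V(z, x₁, x₃ − 1)`, which MEET along a line (part 32a
`roots_F_toy`) — outside the v2 forest (pairwise disjoint members). v3-lite: HOST `(0, S₀ = {x₁, x₂})`, WAITING ENTRY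
`(x₂, e₃, T = {x₁, x₃})` (the second surface in host-relative coordinates: `x₃ ↦ x₃ + 1`; `S₀ ∖ {x₂} = {x₁} ⊆ T ∌ x₂`);
blowing up the host kills the `x₁`-chart and leaves in the `x₂`-chart exactly the waiting kid `{y₁ = 0, y₃ = 1}`
(`cases_pair_one_F_toy`), whose state `y₁^p y₄ + y₁y₃^p` (`step_F_waiting_toy`) dies in both charts of the blow-up of
`V(z, y₁, y₃)` (`not_isEquimultiplePoint_T_H_toy`). Three blow-ups... two nodes with centres of positive dimension, no leaves:

* **`exists_isMarkedResolution_inst₁₁`** (`3 ≤ p`) — `(𝔸⁵_K, (z^p + F)·𝒪, [], p)` admits a marked resolution (BGMW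
  Def. 3.1.3), by part 38's `exists_isMarkedResolution_joint_forest_root_waiting` with `Pl₀ = ∅`, `Wt = {(x₂, e₃, T)}`,
  `L₀ = ∅`, empty plans below. The FIRST certificate for an INTERSECTING root locus. UNCONDITIONAL.

AI-produced formalisation, weaker than expert review. bears_on: LADDER-RESOLUTION:D157-DOOR2 (res-dim4-pi · S3 (c) joint
v3-lite · toy certificate).
-/

set_option linter.dupNamespace false -- D-0017: single-problem summit path `Summit.<S>.<S>.…` by design

noncomputable section

open MvPolynomial Finset CategoryTheory AlgebraicGeometry Opposite TopologicalSpace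

namespace Summit.ResolutionOfSingularities.ResolutionOfSingularities.Theorems.PIDim4

open Literature.AlgebraicGeometry.Resolution
open Literature.AlgebraicGeometry.Resolution.Hauser2010
open Literature.AlgebraicGeometry.Resolution.AffinePointBlowup (P A γ coord Wtop ξ)

namespace Equimultiple

section Instance₁₁

variable {K : Type} [Field K] {p : ℕ} [hp : Fact p.Prime] [CharP K p]

/-- **THE v3-LITE TOY, CERTIFIED** (`p ≥ 3`): `(𝔸⁵_K, (z^p + x₁^p x₄ + x₁x₂^{p−1}(x₃^p − 1))·𝒪, [], p)` admits a marked
resolution — host `V(z, x₁, x₂)` blown up first while `V(z, x₁, x₃ − 1)` waits, then the waiting kid `V(z′, y₁, y₃ − 1)` of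
the `x₂`-chart; nothing of order `p` survives. [cite: BierstoneGrigorievMilmanWlodarczyk2011, Def. 3.1.3]
[cite: HauserPerlega2019PRIMS, §2 (permissible centres P = (z, x_i : i ∈ Γ))] [cite: Hauser2010, §F (equiconstant points)] -/
theorem exists_isMarkedResolution_inst₁₁ [IsAlgClosed K] [DecidableEq K] (hp3 : 3 ≤ p) :
    ∃ (X' : Scheme.{0}) (ρ : X' ⟶ P 4 K) (M' : MarkedIdeal X'),
      IsMarkedResolution (⟨hypSheaf p
        (X 0 ^ p * X 3 + X 0 * X 1 ^ (p - 1) * X 2 ^ p - X 0 * X 1 ^ (p - 1) : MvPolynomial (Fin 4) K), [], p⟩ :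
        MarkedIdeal (P 4 K)) ρ M' := by
  classical
  set F : MvPolynomial (Fin 4) K := X 0 ^ p * X 3 + X 0 * X 1 ^ (p - 1) * X 2 ^ p - X 0 * X 1 ^ (p - 1) with hFdef
  set s₀ : State K := ⟨F, 0, ∅⟩ with hs₀def
  have hs₀ : s₀ = ⟨deletePthPowers p (PointBlowup.translate (0 : Fin 4 → K) F), 0, ∅⟩ := by
    rw [PointBlowup.translate_zero,
      Literature.Barriers.ResolutionOfSingularities.HauserPerlega.deletePthPowers_eq_self isClean_F_toy]
  -- the waiting entry `(x₂, e₃, T)` and its kid pair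
  set wt₀ : Fin 4 × (Fin 4 → K) × Finset (Fin 4) := ((1 : Fin 4), (Pi.single 2 1 : Fin 4 → K), ({0, 2} : Finset (Fin 4)))
    with hwt₀
  set w₁ : State K × Finset (Fin 4) :=
    (CentreBlowup.step p ({0, 1} : Finset (Fin 4)) 1 (Pi.single 2 1 : Fin 4 → K) s₀, ({0, 2} : Finset (Fin 4))) with hw₁
  have hH : (CentreBlowup.step p ({0, 1} : Finset (Fin 4)) 1 (Pi.single 2 1 : Fin 4 → K) s₀).F = X 0 ^ p * X 3 + X 0 * X 2 ^ p := by
    rw [hs₀def, hFdef]; exact step_F_waiting_toy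
  -- the rules below: nothing planned, no leaves
  let plan : State K → Finset (Fin 4) → Finset (Fin 4 × (Fin 4 → K) × Finset (Fin 4)) := fun _ _ => ∅
  let leaves : State K → Finset (Fin 4) → Finset (Fin 4 × (Fin 4 → K)) := fun _ _ => ∅
  have hreach : ∀ q : State K × Finset (Fin 4),
      Relation.ReflTransGen (fun q q' : State K × Finset (Fin 4) =>
        ∃ e ∈ plan q.1 q.2, q' = (CentreBlowup.step p q.2 e.1 e.2.1 q.1, e.2.2)) w₁ q → q = w₁ := by
    intro q hq
    induction hq with
    | refl => rfl
    | tail _ hR _ =>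
      obtain ⟨e, he, -⟩ := hR
      exact absurd he (Finset.notMem_empty e)
  refine exists_isMarkedResolution_joint_forest_root_waiting (p := p) F F_toy_ne_zero isClean_F_toy plan leaves 0
    ({0, 1} : Finset (Fin 4)) s₀ hs₀ isPermissibleCentre_F_toy ∅ {wt₀} ∅
    (fun e he => absurd he (Finset.notMem_empty e)) (fun e he => absurd he (Finset.notMem_empty e))
    (fun wt hwt => ?_) (fun wt hwt wt' hwt' hne => ?_) (fun e he => absurd he (Finset.notMem_empty e))
    (fun l hl => absurd hl (Finset.notMem_empty l)) (fun j' b' hj' hb' _ heq => ?_) (fun q hq => ?_)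
    (fun e he => absurd he (Finset.notMem_empty e)) (fun wt hwt => ?_) (fun b' H => ?_)
  · -- the waiting entry is admissible
    rw [Finset.mem_singleton] at hwt
    subst hwt
    refine ⟨by simp [hwt₀], fun i hi => ?_,
      by show (({0, 1} : Finset (Fin 4)).erase 1) ⊆ ({0, 2} : Finset (Fin 4)); decide,
      by show (1 : Fin 4) ∉ ({0, 2} : Finset (Fin 4)); decide, ?_⟩
    · simp only [Finset.mem_insert, Finset.mem_singleton] at hi
      rcases hi with rfl | rfl <;> simp [hwt₀]
    · change IsPermissibleCentre p ({0, 2} : Finset (Fin 4)) (PointBlowup.translate (Pi.single 2 1 : Fin 4 → K) F)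
      rw [hFdef, translate_e₂_F_toy]
      exact isPermissibleCentre_T_F_toy
  · -- one waiting entry only
    rw [Finset.mem_singleton] at hwt hwt'
    exact absurd (hwt.trans hwt'.symm) hne
  · -- the three-way cover over the host: the `x₁`-chart is dead, the `x₂`-chart pairs lie on the waiting kid
    simp only [Finset.mem_insert, Finset.mem_singleton] at hj'
    rcases hj' with rfl | rfl
    · exact absurd heq (not_isEquimultiplePoint_pair_zero_F_toy b' s₀ rfl)
    · obtain ⟨hb0, hb2⟩ := cases_pair_one_F_toy s₀ rfl heq
      refine Or.inr (Or.inl ⟨wt₀, Finset.mem_singleton_self _, rfl, fun i hi => ?_⟩)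
      change i ∈ ({0, 2} : Finset (Fin 4)) at hi
      simp only [Finset.mem_insert, Finset.mem_singleton] at hi
      rcases hi with rfl | rfl
      · rw [hb0]; simp [hwt₀]
      · rw [hb2]; simp [hwt₀]
  · -- below the waiting kid: dead (no children, no leaves, no equimultiple pair)
    rcases hq with ⟨e, he, -⟩ | ⟨wt, hwt, hq⟩
    · exact absurd he (Finset.notMem_empty e)
    · rw [Finset.mem_singleton] at hwt
      subst hwt
      have hqw : q = w₁ := hreach q hq
      subst hqw
      refine ⟨fun e he => absurd he (Finset.notMem_empty e), fun e he => absurd he (Finset.notMem_empty e),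
        fun l hl => absurd hl (Finset.notMem_empty l), fun j'' b'' hj'' hb'' _ heq => ?_⟩
      exact absurd heq (not_isEquimultiplePoint_T_H_toy hp3 hj'' b'' hb'' _ hH)
  · -- `Acc` below the waiting kid: no move
    exact Acc.intro _ fun q' ⟨e, he, _⟩ => absurd he (Finset.notMem_empty e)
  · -- the root cover: `b₁ = 0` and (`b₂ = 0` — the host — or `b₃ = 1` — the waiting member)
    obtain ⟨hb0, hb⟩ := roots_F_toy b' H
    rcases hb with hb1 | hb2
    · left
      intro i hi
      simp only [Finset.mem_insert, Finset.mem_singleton] at hi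
      rcases hi with rfl | rfl
      · rw [hb0]; rfl
      · rw [hb1]; rfl
    · right
      refine ⟨wt₀, Finset.mem_singleton_self _, fun i hi => ?_⟩
      change i ∈ ({0, 2} : Finset (Fin 4)) at hi
      simp only [Finset.mem_insert, Finset.mem_singleton] at hi
      rcases hi with rfl | rfl
      · rw [hb0]; simp [hwt₀]
      · rw [hb2]; simp [hwt₀]

end Instance₁₁

end Equimultiple

end Summit.ResolutionOfSingularities.ResolutionOfSingularities.Theorems.PIDim4

end
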